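import Summits.Schanuel.Schanuel.Theses.RigidCore
import Literature.NumberTheory.Transcendental.ExpPointsExamples
import Literature.NumberTheory.Transcendental.ExpPointsDegenerateSections
import Literature.NumberTheory.Transcendental.ExpPointsConstantExponential

/-!
# Stub `stub_classicalClassesFinite` (H) of line `cusp-germ-schneider-sparsity`

Crux `RigidCore.SparsityTwo` (item stmt-Schanuel-0971): for `W ⊆ ℂ² × ℂ²` defined over `ℚ`
(`IsDefinedOver ⊥ W`) with `zariskiDim ℂ W < 2`, the two "classical classes" of independent
exponential points are finite:

1. **degenerate sections** — for `(a, b) ∈ ℤ² ∖ 0` and any `c ∈ ℂ`, finitely many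
   `x ∈ indepExpPoints W` satisfy `a x₀ + b x₁ = c`
   (`Literature.NumberTheory.Transcendental.finite_indepExpPoints_section`);
2. **constant exponential** — for any `ω ∈ ℂ²`, finitely many `x ∈ indepExpPoints W` have
   `eˣ = ω` (`Literature.NumberTheory.Transcendental.finite_indepExpPoints_fibre`).

Both are proved in the Literature files from Hermite–Lindemann (`transcendental_exp_holds`) and
the transcendence of `π` (`transcendental_pi_holds`) only — no Baker: (1) on a curve component of
`W ∩ {a x₀ + b x₁ = c}` the constants `c` and `e^c = y₀^a y₁^b` are `ℚ`-rational functions of the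
generic point, hence algebraic (the component lies on the `ℚ`-variety `W` of dimension `≤ 1`), so
`c = 0`; (2) a curve component of the fibre `W ∩ {y = ω}` projects to a plane curve through
infinitely many points of `u + 2πi ℤ²` (`e^u = ω`), generated by an absolutely irreducible
`ℚ̄`-factor `G` of a rational relation, with `G(u + 2πi V) ∈ ℂ · ℚ[V]` (Zariski density of the
integer points), and the rigidity theorem
`Literature.NumberTheory.Transcendental.LogLattice.not_linearIndependent_of_bind₁_affine_eq`
forces all such points to be `ℚ`-linearly dependent. This is the step of the line where the
`ℚ`-definedness of `W` is consumed (the disprover's `expLineE`, defined over `ℚ(e)`, fails (2)).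
-/

namespace Summit.Schanuel.Schanuel.Cruxes.SparsityTwo.CuspGermSchneiderSparsity

open Filter Topology Complex Polynomial Literature.NumberTheory.Transcendental
open scoped Real

/-- **stub_classicalClassesFinite** (H): for `W ⊆ ℂ² × ℂ²` defined over `ℚ` with
`zariskiDim ℂ W < 2`, (1) every degenerate section `a x₀ + b x₁ = c` (`(a, b) ∈ ℤ² ∖ 0`,
`c ∈ ℂ`) and (2) every fibre `eˣ = ω` (`ω ∈ ℂ²`) contains only finitely many `ℚ`-linearly
independent exponential points of `W` (the Hermite–Lindemann classes; proved from
`transcendental_exp_holds` and `transcendental_pi_holds`). -/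
theorem stub_classicalClassesFinite :
    ∀ (W : Set (Fin 2 ⊕ Fin 2 → ℂ)), IsDefinedOver (⊥ : Subfield ℂ) W → zariskiDim ℂ W < 2 →
      (∀ a b : ℤ, (a ≠ 0 ∨ b ≠ 0) → ∀ c : ℂ,
        Set.Finite {x : Fin 2 → ℂ | x ∈ indepExpPoints W ∧ (a : ℂ) * x 0 + (b : ℂ) * x 1 = c}) ∧
      (∀ ω : Fin 2 → ℂ,
        Set.Finite {x : Fin 2 → ℂ | x ∈ indepExpPoints W ∧ Complex.exp ∘ x = ω}) :=
  fun W hW hdim =>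
    ⟨fun a b hab c => finite_indepExpPoints_section W hW hdim a b hab c,
      fun ω => finite_indepExpPoints_fibre W hW hdim ω⟩

end Summit.Schanuel.Schanuel.Cruxes.SparsityTwo.CuspGermSchneiderSparsity
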